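import Literature.Geometry.Symplectic.SphereCROperatorJet
import Mathlib.Analysis.Calculus.FDeriv.Symmetric
import HarnessLib

/-!
# First variation of the chart Cauchy–Riemann operator of a sphere

Layer B4c of the analytic core of the Hofer–Lizan–Sikorav local foliation theorem (Wendl 2018,
Thm. 2.46 / Prop. 2.53; lead of crux `WitnessCharge`, summit `SmoothPoincare4`). For the chart-`0`
Cauchy–Riemann operator `crOp₀ ξ f z = Φ₀ z (crExpr J₀ (vmap₀ ξ f) z)` of
`SphereCROperatorPointwise.lean` we compute the derivative at `s = 0` of
`s ↦ crOp₀ (ξ₁ + s δξ) (f₁ + s δf) z` at a solution (`crExpr J₀ (vmap₀ ξ₁ f₁) z = 0`):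

* `dvmap₀ ξ₁ δξ δf` — the variation field `∂ₛ|₀ vmap₀ (ξ₁ + s δξ) (f₁ + s δf)`
  (`hasDerivAt_vmap₀_variation`), equal to `(δξ, Q₀⁻¹ δf)` along the zero section (`dvmap₀_zero`);
* `hasDerivAt_fderiv_vmap₀_variation` — the `s`-derivative of the `z`-differential of the family
  is the `z`-differential of the variation field (symmetry of second derivatives of the
  two-parameter map `(s, z) ↦ vmap₀ (ξ₁ + s δξ) (f₁ + s δf) z`, packaged abstractly in
  `hasDerivAt_fderiv_slice`);
* `hasDerivAt_crOp₀_variation` — THE FIRST VARIATION FORMULA: at a solution only the term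
  `Φ₀ (D_z(dvmap₀) 1 + J₀ D_z(dvmap₀) I + (DJ₀ · dvmap₀) D_z(vmap₀) I)` survives, i.e. the
  linearisation is `Φ₀` applied to the standard linearised Cauchy–Riemann operator
  `η ↦ ∂ₛη + J ∂ₜη + (∇_η J) ∂ₜu` (Wendl 2018, §2.1; McDuff–Salamon 2012, Prop. 3.1.1).

## References

* C. Wendl, *Holomorphic Curves in Low Dimensions*, LNM 2216 (2018), §2.1, Thm. 2.46. [Wendl2018]
* D. McDuff, D. Salamon, *J-holomorphic Curves and Symplectic Topology*, 2nd ed. (2012), §3.1.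
  [McDuffSalamon2012]
-/

noncomputable section

open Complex Set Filter
open scoped Topology ContDiff
open Literature.Analysis.Complex.ProjectiveLineExpChart Literature.Geometry.Symplectic.CRExpression

namespace Literature.Geometry.Symplectic

namespace SphereCR

/-! ### Calculus: affine curves and mixed partial derivatives of a two-parameter map -/

/-- The affine curve `s ↦ a + s • b` has derivative `b` everywhere. [folklore] -/
theorem hasDerivAt_const_add_smul {Y : Type*} [NormedAddCommGroup Y] [NormedSpace ℝ Y]
    (a b : Y) (s₀ : ℝ) : HasDerivAt (fun s : ℝ => a + s • b) b s₀ := by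
  simpa using ((hasDerivAt_id s₀).smul_const b).const_add a

/-- **Mixed partials of a two-parameter map.** If `G : ℝ × E → Y` is `C²` at `(0, z)`, then the
`s`-derivative at `0` of the differential (at `z`, in the direction `e`) of the slice `G (s, ·)`
is the differential at `z` in the direction `e` of the `s`-derivative `z' ↦ ∂ₛ|₀ G (s, z')`
(symmetry of the second derivative, `ContDiffAt.isSymmSndFDerivAt`). [folklore] -/
theorem hasDerivAt_fderiv_slice {E Y : Type*} [NormedAddCommGroup E] [NormedSpace ℝ E]
    [NormedAddCommGroup Y] [NormedSpace ℝ Y] {G : ℝ × E → Y} {z : E}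
    (hG : ContDiffAt ℝ 2 G (0, z)) (e : E) :
    HasDerivAt (fun s : ℝ => fderiv ℝ (fun z' => G (s, z')) z e)
      (fderiv ℝ (fun z' => deriv (fun s : ℝ => G (s, z')) 0) z e) 0 := by
  -- `G` is differentiable near `(0, z)`, `DG` is differentiable at `(0, z)`, `D²G` is symmetric
  have hGd : ∀ᶠ p in 𝓝 ((0 : ℝ), z), DifferentiableAt ℝ G p := by
    filter_upwards [hG.eventually (by simp)] with p hp
    exact hp.differentiableAt (by simp)
  have hDG : DifferentiableAt ℝ (fderiv ℝ G) (0, z) :=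
    (hG.fderiv_right (m := 1) (by norm_num)).differentiableAt (by simp)
  have hsymm : IsSymmSndFDerivAt ℝ G (0, z) :=
    hG.isSymmSndFDerivAt (by simp [minSmoothness_of_isRCLikeNormedField])
  -- (a) for `s` near `0` the differential of the slice is a partial derivative of `G`
  have ha : (fun s : ℝ => fderiv ℝ (fun z' => G (s, z')) z e) =ᶠ[𝓝 0]
      fun s => fderiv ℝ G (s, z) (0, e) := by
    have hc : Continuous fun s : ℝ => ((s, z) : ℝ × E) := continuous_id'.prodMk continuous_const
    filter_upwards [hc.continuousAt.eventually hGd] with s hs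
    have h : HasFDerivAt (fun z' => G (s, z'))
        ((fderiv ℝ G (s, z)).comp (ContinuousLinearMap.inr ℝ ℝ E)) z :=
      hs.hasFDerivAt.comp z (hasFDerivAt_prodMk_right (𝕜 := ℝ) s z)
    rw [h.fderiv, ContinuousLinearMap.comp_apply, ContinuousLinearMap.inr_apply]
  -- (b) the `s`-derivative of that partial derivative is a second derivative of `G`
  have hb : HasDerivAt (fun s : ℝ => fderiv ℝ G (s, z) (0, e))
      (fderiv ℝ (fderiv ℝ G) (0, z) (1, 0) (0, e)) 0 := by
    have hc : HasDerivAt (fun s : ℝ => ((s, z) : ℝ × E)) ((1 : ℝ), (0 : E)) 0 :=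
      (hasDerivAt_id (0 : ℝ)).prodMk (hasDerivAt_const (0 : ℝ) z)
    have h := (hDG.hasFDerivAt.comp_hasDerivAt_of_eq (0 : ℝ) hc rfl).clm_apply
      (hasDerivAt_const (0 : ℝ) (((0 : ℝ), e) : ℝ × E))
    simpa using h
  -- (c) near `z`, the partial `s`-derivative at `s = 0` is the derivative of the `s`-slice
  have he : (fun z' => fderiv ℝ G (0, z') (1, 0)) =ᶠ[𝓝 z]
      fun z' => deriv (fun s : ℝ => G (s, z')) 0 := by
    have hc : Continuous fun z' : E => (((0 : ℝ), z') : ℝ × E) :=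
      continuous_const.prodMk continuous_id'
    filter_upwards [hc.continuousAt.eventually hGd] with z' hz'
    have hc' : HasDerivAt (fun s : ℝ => ((s, z') : ℝ × E)) ((1 : ℝ), (0 : E)) 0 :=
      (hasDerivAt_id (0 : ℝ)).prodMk (hasDerivAt_const (0 : ℝ) z')
    exact (hz'.hasFDerivAt.comp_hasDerivAt_of_eq (0 : ℝ) hc' rfl).deriv.symm
  -- (d) the `z'`-derivative of the partial `s`-derivative is the transposed second derivative
  have hd : fderiv ℝ (fun z' => fderiv ℝ G (0, z') (1, 0)) z e =
      fderiv ℝ (fderiv ℝ G) (0, z) (0, e) (1, 0) := by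
    have h : HasFDerivAt (fun z' => fderiv ℝ G (0, z') ((1 : ℝ), (0 : E)))
        ((fderiv ℝ G (0, z)).comp (0 : E →L[ℝ] ℝ × E) +
          ((fderiv ℝ (fderiv ℝ G) (0, z)).comp (ContinuousLinearMap.inr ℝ ℝ E)).flip (1, 0)) z :=
      (hDG.hasFDerivAt.comp z (hasFDerivAt_prodMk_right (𝕜 := ℝ) (0 : ℝ) z)).clm_apply
        (hasFDerivAt_const (((1 : ℝ), (0 : E)) : ℝ × E) z)
    rw [h.fderiv]
    simp
  refine (hb.congr_of_eventuallyEq ha).congr_deriv ?_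
  rw [hsymm (1, 0) (0, e), ← hd, he.fderiv_eq]

namespace SphereACData

variable (𝒥 : SphereACData)

/-! ### The variation field of the chart-`0` map -/

/-- The variation field `∂ₛ|₀ vmap₀ (ξ₁ + s δξ) (f₁ + s δf)`:
`z ↦ (D(expChart)(z, ξ₁ z) (0, δξ z), Q₀(z)⁻¹ (δf z))`. [cite: Wendl2018, Thm. 2.46] -/
def dvmap₀ (ξ₁ δξ δf : ℂ → ℂ) (z : ℂ) : ℂ × ℂ :=
  (fderivExpChart (z, ξ₁ z) (0, δξ z), 𝒥.Qinv₀ z (δf z))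

/-- Along the zero section (`ξ₁ = 0`) the variation field is `(δξ, Q₀⁻¹ δf)` (the `c`-derivative
of the exponential chart at `c = 0` is the identity). [folklore] -/
theorem dvmap₀_zero (δξ δf : ℂ → ℂ) (z : ℂ) : 𝒥.dvmap₀ 0 δξ δf z = (δξ z, 𝒥.Qinv₀ z (δf z)) := by
  simp [dvmap₀]

/-- `dvmap₀_zero` as an equality of functions: along the zero section the variation field is
`z ↦ (δξ z, Q₀(z)⁻¹ (δf z))`. [folklore] -/
theorem dvmap₀_zero_eq (δξ δf : ℂ → ℂ) :
    𝒥.dvmap₀ 0 δξ δf = fun z => ((δξ z, 𝒥.Qinv₀ z (δf z)) : ℂ × ℂ) :=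
  funext (𝒥.dvmap₀_zero δξ δf)

/-- **The variation of the chart-`0` map**: `s ↦ vmap₀ (ξ₁ + s δξ) (f₁ + s δf) z` has derivative
`dvmap₀ ξ₁ δξ δf z` at `s = 0` (chain rule through the exponential chart, wherever
`den z (ξ₁ z) ≠ 0`). [cite: Wendl2018, Thm. 2.46] -/
theorem hasDerivAt_vmap₀_variation {ξ₁ f₁ δξ δf : ℂ → ℂ} {z : ℂ} (hden : den z (ξ₁ z) ≠ 0) :
    HasDerivAt (fun s : ℝ => 𝒥.vmap₀ (ξ₁ + s • δξ) (f₁ + s • δf) z) (𝒥.dvmap₀ ξ₁ δξ δf z) 0 := by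
  have h1 : HasDerivAt (fun s : ℝ => expChart z (ξ₁ z + s • δξ z))
      (fderivExpChart (z, ξ₁ z) (0, δξ z)) 0 := by
    have hc : HasDerivAt (fun s : ℝ => ((z, ξ₁ z + s • δξ z) : ℂ × ℂ)) ((0 : ℂ), δξ z) 0 :=
      (hasDerivAt_const (0 : ℝ) z).prodMk (hasDerivAt_const_add_smul (ξ₁ z) (δξ z) 0)
    exact (hasFDerivAt_expChart (z, ξ₁ z) hden).comp_hasDerivAt_of_eq 0 hc (by simp)
  have h2 : HasDerivAt (fun s : ℝ => 𝒥.Qinv₀ z (f₁ z + s • δf z)) (𝒥.Qinv₀ z (δf z)) 0 :=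
    (𝒥.Qinv₀ z).hasFDerivAt.comp_hasDerivAt (0 : ℝ) (hasDerivAt_const_add_smul (f₁ z) (δf z) 0)
  exact h1.prodMk h2

/-- The two-parameter map `(s, z) ↦ vmap₀ (ξ₁ + s δξ) (f₁ + s δf) z` is `C²` at every point
where the exponential chart is defined, for `C²` data. [folklore] -/
theorem contDiffAt_vmap₀_family {ξ₁ f₁ δξ δf : ℂ → ℂ} (hξ₁ : ContDiff ℝ 2 ξ₁)
    (hf₁ : ContDiff ℝ 2 f₁) (hδξ : ContDiff ℝ 2 δξ) (hδf : ContDiff ℝ 2 δf) {p : ℝ × ℂ}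
    (hden : den p.2 (ξ₁ p.2 + p.1 • δξ p.2) ≠ 0) :
    ContDiffAt ℝ 2 (fun q : ℝ × ℂ => 𝒥.vmap₀ (ξ₁ + q.1 • δξ) (f₁ + q.1 • δf) q.2) p := by
  have h1 : ContDiffAt ℝ 2 (fun q : ℝ × ℂ => expChart q.2 (ξ₁ q.2 + q.1 • δξ q.2)) p := by
    have hin : ContDiff ℝ 2 (fun q : ℝ × ℂ => ((q.2, ξ₁ q.2 + q.1 • δξ q.2) : ℂ × ℂ)) :=
      contDiff_snd.prodMk ((hξ₁.comp contDiff_snd).add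
        (contDiff_fst.fun_smul (hδξ.comp contDiff_snd)))
    exact (contDiffAt_expChart (p := (p.2, ξ₁ p.2 + p.1 • δξ p.2)) hden).comp p hin.contDiffAt
  have hQ : ContDiff ℝ 2 𝒥.Qinv₀ := contDiff_infty.1 𝒥.contDiff_Qinv₀_and.1 2
  have h2 : ContDiffAt ℝ 2 (fun q : ℝ × ℂ => 𝒥.Qinv₀ q.2 (f₁ q.2 + q.1 • δf q.2)) p :=
    ((hQ.comp contDiff_snd).clm_apply ((hf₁.comp contDiff_snd).add
      (contDiff_fst.fun_smul (hδf.comp contDiff_snd)))).contDiffAt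
  exact h1.prodMk h2

/-- **Mixed partials for the chart-`0` family**: for `C²` data, the `s`-derivative at `0` of the
`z`-differential of `vmap₀ (ξ₁ + s δξ) (f₁ + s δf)` is the `z`-differential of the variation field
`dvmap₀ ξ₁ δξ δf`. [cite: Wendl2018, Thm. 2.46] -/
theorem hasDerivAt_fderiv_vmap₀_variation {ξ₁ f₁ δξ δf : ℂ → ℂ} {z : ℂ} (hξ₁ : ContDiff ℝ 2 ξ₁)
    (hf₁ : ContDiff ℝ 2 f₁) (hδξ : ContDiff ℝ 2 δξ) (hδf : ContDiff ℝ 2 δf)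
    (hden : den z (ξ₁ z) ≠ 0) (e : ℂ) :
    HasDerivAt (fun s : ℝ => fderiv ℝ (𝒥.vmap₀ (ξ₁ + s • δξ) (f₁ + s • δf)) z e)
      (fderiv ℝ (𝒥.dvmap₀ ξ₁ δξ δf) z e) 0 := by
  set G : ℝ × ℂ → ℂ × ℂ := fun q => 𝒥.vmap₀ (ξ₁ + q.1 • δξ) (f₁ + q.1 • δf) q.2 with hG
  have hGc : ContDiffAt ℝ 2 G (0, z) :=
    𝒥.contDiffAt_vmap₀_family hξ₁ hf₁ hδξ hδf (by simpa using hden)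
  have h := hasDerivAt_fderiv_slice hGc e
  -- near `z` the `s`-derivative of the slice at `s = 0` is the variation field
  have he : (fun z' => deriv (fun s : ℝ => G (s, z')) 0) =ᶠ[𝓝 z] 𝒥.dvmap₀ ξ₁ δξ δf := by
    have hc : Continuous fun z' : ℂ => ((z', ξ₁ z') : ℂ × ℂ) :=
      continuous_id'.prodMk hξ₁.continuous
    filter_upwards [hc.continuousAt.eventually_mem (isOpen_den_ne_zero.mem_nhds hden)]
      with z' hz'
    exact (𝒥.hasDerivAt_vmap₀_variation hz').deriv
  rw [he.fderiv_eq] at h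
  exact h

/-! ### The first variation of the operator -/

/-- **First variation of the chart-`0` Cauchy–Riemann operator at a solution.** For `C²` data
`ξ₁, f₁, δξ, δf` with `den z (ξ₁ z) ≠ 0` and `crExpr J₀ (vmap₀ ξ₁ f₁) z = 0`, the curve
`s ↦ crOp₀ (ξ₁ + s δξ) (f₁ + s δf) z` has derivative at `s = 0`
`Φ₀ z (D(dvmap₀)(z) 1 + J₀ (vmap₀ z) (D(dvmap₀)(z) I) + (DJ₀ (vmap₀ z) (dvmap₀ z)) (D(vmap₀)(z) I))`
(everything at `(ξ₁, f₁)`): by the product rule the derivative of the transport `Φ₀` does not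
contribute at a zero of `crExpr`, and the Cauchy–Riemann expression differentiates to the
linearised operator (`hasDerivAt_fderiv_vmap₀_variation`, chain rule for `J₀ ∘ vmap₀`).
[cite: Wendl2018, Thm. 2.46] -/
theorem hasDerivAt_crOp₀_variation {ξ₁ f₁ δξ δf : ℂ → ℂ} {z : ℂ} (hξ₁ : ContDiff ℝ 2 ξ₁)
    (hf₁ : ContDiff ℝ 2 f₁) (hδξ : ContDiff ℝ 2 δξ) (hδf : ContDiff ℝ 2 δf)
    (hden : den z (ξ₁ z) ≠ 0) (hsol : crExpr 𝒥.J₀ (𝒥.vmap₀ ξ₁ f₁) z = 0) :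
    HasDerivAt (fun s : ℝ => 𝒥.crOp₀ (ξ₁ + s • δξ) (f₁ + s • δf) z)
      (𝒥.Phi₀ ξ₁ f₁ z (fderiv ℝ (𝒥.dvmap₀ ξ₁ δξ δf) z 1 +
        𝒥.J₀ (𝒥.vmap₀ ξ₁ f₁ z) (fderiv ℝ (𝒥.dvmap₀ ξ₁ δξ δf) z I) +
          (fderiv ℝ 𝒥.J₀ (𝒥.vmap₀ ξ₁ f₁ z) (𝒥.dvmap₀ ξ₁ δξ δf z))
            (fderiv ℝ (𝒥.vmap₀ ξ₁ f₁) z I))) 0 := by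
  have h0ξ : ξ₁ + (0 : ℝ) • δξ = ξ₁ := by simp
  have h0f : f₁ + (0 : ℝ) • δf = f₁ := by simp
  show HasDerivAt (fun s : ℝ => 𝒥.PhiJet₀ z (ξ₁ z + s • δξ z) (f₁ z + s • δf z)
    (crExpr 𝒥.J₀ (𝒥.vmap₀ (ξ₁ + s • δξ) (f₁ + s • δf)) z)) _ 0
  -- the transport `Φ(s)` is differentiable in `s`
  have hΦ : DifferentiableAt ℝ
      (fun s : ℝ => 𝒥.PhiJet₀ z (ξ₁ z + s • δξ z) (f₁ z + s • δf z)) 0 := by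
    have hopen : IsOpen {p : ℂ × ℂ × ℂ | den p.1 p.2.1 ≠ 0} :=
      isOpen_den_ne_zero.preimage (continuous_fst.prodMk (continuous_fst.comp continuous_snd))
    have hmem : ((z, ξ₁ z + (0 : ℝ) • δξ z, f₁ z + (0 : ℝ) • δf z) : ℂ × ℂ × ℂ) ∈
        {p : ℂ × ℂ × ℂ | den p.1 p.2.1 ≠ 0} := by
      simpa using hden
    have hP : ContDiffAt ℝ ∞ (fun p : ℂ × ℂ × ℂ => 𝒥.PhiJet₀ p.1 p.2.1 p.2.2)
        (z, ξ₁ z + (0 : ℝ) • δξ z, f₁ z + (0 : ℝ) • δf z) :=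
      𝒥.contDiffOn_PhiJet₀.contDiffAt (hopen.mem_nhds hmem)
    have hcurve : ContDiff ℝ ∞
        (fun s : ℝ => ((z, ξ₁ z + s • δξ z, f₁ z + s • δf z) : ℂ × ℂ × ℂ)) :=
      contDiff_const.prodMk ((contDiff_const.add (contDiff_id.fun_smul contDiff_const)).prodMk
        (contDiff_const.add (contDiff_id.fun_smul contDiff_const)))
    exact (hP.comp (0 : ℝ) hcurve.contDiffAt).differentiableAt (by simp)
  -- the Cauchy–Riemann expression `W(s)` and its derivative
  have hW : HasDerivAt (fun s : ℝ => crExpr 𝒥.J₀ (𝒥.vmap₀ (ξ₁ + s • δξ) (f₁ + s • δf)) z)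
      (fderiv ℝ (𝒥.dvmap₀ ξ₁ δξ δf) z 1 +
        ((fderiv ℝ 𝒥.J₀ (𝒥.vmap₀ ξ₁ f₁ z) (𝒥.dvmap₀ ξ₁ δξ δf z))
            (fderiv ℝ (𝒥.vmap₀ ξ₁ f₁) z I) +
          𝒥.J₀ (𝒥.vmap₀ ξ₁ f₁ z) (fderiv ℝ (𝒥.dvmap₀ ξ₁ δξ δf) z I))) 0 := by
    have h1 := 𝒥.hasDerivAt_fderiv_vmap₀_variation hξ₁ hf₁ hδξ hδf hden 1
    have hI := 𝒥.hasDerivAt_fderiv_vmap₀_variation hξ₁ hf₁ hδξ hδf hden I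
    have hJ : HasDerivAt (fun s : ℝ => 𝒥.J₀ (𝒥.vmap₀ (ξ₁ + s • δξ) (f₁ + s • δf) z))
        (fderiv ℝ 𝒥.J₀ (𝒥.vmap₀ ξ₁ f₁ z) (𝒥.dvmap₀ ξ₁ δξ δf z)) 0 := by
      have hd : DifferentiableAt ℝ 𝒥.J₀ (𝒥.vmap₀ ξ₁ f₁ z) :=
        (𝒥.smooth₀.differentiable (by simp)).differentiableAt
      exact hd.hasFDerivAt.comp_hasDerivAt_of_eq 0 (𝒥.hasDerivAt_vmap₀_variation hden)
        (by simp)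
    refine (h1.fun_add (hJ.clm_apply hI)).congr_deriv ?_
    simp only [h0ξ, h0f]
  refine (hΦ.hasDerivAt.clm_apply hW).congr_deriv ?_
  simp only [zero_smul, add_zero, hsol, map_zero, zero_add, Phi₀_eq_PhiJet₀]
  congr 1
  abel

end SphereACData

end SphereCR

end Literature.Geometry.Symplectic

end
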